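import Summits.CriticalPhenomena.PercolationContinuityZ3.Theorems.Transplant.FKConnectivityAllQAntipodalPivotSplit
import HarnessLib

/-!
# Connectivity correlation inequalities for `φ_{w,q}`, every `q > 0` — file 76c: **THE ONE-SIDED INDUCTION RULE CLOSES `C_∞⁺` FOR EVERY `|S|`**
# (assembly of the pivot split, file 76b)

Support file (`--supports stmt-CriticalPhenomena-4575`), FK sub-lane `prim-bschramm-fk-2` (gen 34); builds on p205010 (kernel theorem, internal audit
signed; external expert review pending).  No definitions, no named facts, no sorries; standard axioms.

Fix a cell `(M, C)`, a second test function `g` and a cut-off `J`, and write `Σ(f) = Σ_{ℓ(γ)≤J} (f(γ∪C) − f((M∖γ)∪C))·(g(γ∪C) − g((M∖γ)∪C))`.  Say that the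
RULE holds on the read set `S` if for every `S' ⊆ S` and every increasing `f` reading only `S'` one of the following is available:
(o) `Σ(f) ≤ 0` outright (the base case — e.g. `f` an AND, file 32dW, or `f` constant), or
(l) an edge `e ∈ S'` with the LOWERING certificate `Σ_{ℓ≤J} (f(γ∪C) − f((γ∪C)∖{e}))·ĝ ≤ 0`, or
(r) an edge `e ∈ S'` with the RAISING certificate `Σ_{ℓ≤J} (f(insert e (γ∪C)) − f(γ∪C))·ĝ ≥ 0`.
**`FK.levels_le_of_rule`**: if the RULE holds on `S` then `Σ(f) ≤ 0` for every increasing `f` reading only a subset of `S` — by induction on the number of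
read edges, using `FK.levels_le_of_lower` / `FK.levels_le_of_raise` (file 76b): `f ∘ (· ∖ {e})` and `f ∘ insert e` are increasing and read one edge fewer.
This is the exact shape in which the all-levels conjecture `C_∞⁺` (memo FROM-fk-2-g34-SEPARATED-AND-RULES, FK-Q2 §43) reduces to the existence of an
admissible edge; the existence holds in all 26.36·10⁹ exact instances on the 2-connected series–parallel hosts with ≤ 9 edges (multiplicity ≤ 2, `|S| ≤ 5`).
[cite: Grimmett2006, §1.4 eq. (1.20) (p. 15); §3.8 Thm. (3.90) (pp. 61–62)] [cite: Wagner2006, Thm. 5.8(d), §5.3]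
-/

noncomputable section

namespace Summit.CriticalPhenomena.PercolationContinuityZ3.Theorems

namespace FK

open SimpleGraph Literature.Probability.LatticeModels Literature.Probability.Percolation
open scoped Classical

variable {V : Type*}

/-- Lowering one coordinate keeps a function increasing. [folklore] -/
theorem mono_comp_sdiff_singleton {f : Finset (Sym2 V) → ℝ} (hfm : ∀ ⦃A B : Finset (Sym2 V)⦄, A ⊆ B → f A ≤ f B) (e : Sym2 V) :
    ∀ ⦃A B : Finset (Sym2 V)⦄, A ⊆ B → f (A \ {e}) ≤ f (B \ {e}) :=
  fun _ _ hAB => hfm (Finset.sdiff_subset_sdiff hAB le_rfl)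

/-- Raising one coordinate keeps a function increasing. [folklore] -/
theorem mono_comp_insert {f : Finset (Sym2 V) → ℝ} (hfm : ∀ ⦃A B : Finset (Sym2 V)⦄, A ⊆ B → f A ≤ f B) (e : Sym2 V) :
    ∀ ⦃A B : Finset (Sym2 V)⦄, A ⊆ B → f (insert e A) ≤ f (insert e B) :=
  fun _ _ hAB => hfm (Finset.insert_subset_insert e hAB)

/-- Lowering the coordinate `e` of a function reading only `S'` gives a function reading only `S'.erase e`. [folklore] -/
theorem notRead_comp_sdiff_singleton {f : Finset (Sym2 V) → ℝ} {S' : Finset (Sym2 V)}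
    (hf : ∀ e' : Sym2 V, e' ∉ S' → ∀ A : Finset (Sym2 V), f (insert e' A) = f A) (e : Sym2 V) :
    ∀ e' : Sym2 V, e' ∉ S'.erase e → ∀ A : Finset (Sym2 V), f (insert e' A \ {e}) = f (A \ {e}) := by
  intro e' he' A
  by_cases h : e' = e
  · subst h
    rw [Finset.insert_sdiff_of_mem _ (Finset.mem_singleton_self _)]
  · have he'S : e' ∉ S' := fun hS => he' (Finset.mem_erase.2 ⟨h, hS⟩)
    rw [Finset.insert_sdiff_of_notMem _ (fun hm => h (Finset.mem_singleton.1 hm)), hf e' he'S]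

/-- Raising the coordinate `e` of a function reading only `S'` gives a function reading only `S'.erase e`. [folklore] -/
theorem notRead_comp_insert {f : Finset (Sym2 V) → ℝ} {S' : Finset (Sym2 V)}
    (hf : ∀ e' : Sym2 V, e' ∉ S' → ∀ A : Finset (Sym2 V), f (insert e' A) = f A) (e : Sym2 V) :
    ∀ e' : Sym2 V, e' ∉ S'.erase e → ∀ A : Finset (Sym2 V), f (insert e (insert e' A)) = f (insert e A) := by
  intro e' he' A
  by_cases h : e' = e
  · subst h
    rw [Finset.insert_idem]
  · have he'S : e' ∉ S' := fun hS => he' (Finset.mem_erase.2 ⟨h, hS⟩)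
    rw [Finset.insert_comm, hf e' he'S]

/-- **The one-sided induction rule closes `C_∞⁺` for every read set.**  See the module docstring.
[cite: Grimmett2006, §3.8 Thm. (3.90) (pp. 61–62); §3.9 (pp. 63–64)] [cite: Wagner2006, Thm. 5.8(d), §5.3] -/
theorem levels_le_of_rule (M C S : Finset (Sym2 V)) (g : Finset (Sym2 V) → ℝ) (J : ℕ)
    (hrule : ∀ S' : Finset (Sym2 V), S' ⊆ S → ∀ f : Finset (Sym2 V) → ℝ,
      (∀ e : Sym2 V, e ∉ S' → ∀ A : Finset (Sym2 V), f (insert e A) = f A) →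
      (∀ ⦃A B : Finset (Sym2 V)⦄, A ⊆ B → f A ≤ f B) →
      (∑ γ ∈ M.powerset with apExpC M C γ ≤ J, (f (γ ∪ C) - f (M \ γ ∪ C)) * (g (γ ∪ C) - g (M \ γ ∪ C)) ≤ 0) ∨
      (∃ e ∈ S', ∑ γ ∈ M.powerset with apExpC M C γ ≤ J,
          (f (γ ∪ C) - f ((γ ∪ C) \ {e})) * (g (γ ∪ C) - g (M \ γ ∪ C)) ≤ 0) ∨
      (∃ e ∈ S', 0 ≤ ∑ γ ∈ M.powerset with apExpC M C γ ≤ J,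
          (f (insert e (γ ∪ C)) - f (γ ∪ C)) * (g (γ ∪ C) - g (M \ γ ∪ C)))) :
    ∀ S' : Finset (Sym2 V), S' ⊆ S → ∀ f : Finset (Sym2 V) → ℝ,
      (∀ e : Sym2 V, e ∉ S' → ∀ A : Finset (Sym2 V), f (insert e A) = f A) →
      (∀ ⦃A B : Finset (Sym2 V)⦄, A ⊆ B → f A ≤ f B) →
      ∑ γ ∈ M.powerset with apExpC M C γ ≤ J, (f (γ ∪ C) - f (M \ γ ∪ C)) * (g (γ ∪ C) - g (M \ γ ∪ C)) ≤ 0 := by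
  -- induction on the number of read edges
  suffices key : ∀ n : ℕ, ∀ S' : Finset (Sym2 V), S'.card ≤ n → S' ⊆ S → ∀ f : Finset (Sym2 V) → ℝ,
      (∀ e : Sym2 V, e ∉ S' → ∀ A : Finset (Sym2 V), f (insert e A) = f A) →
      (∀ ⦃A B : Finset (Sym2 V)⦄, A ⊆ B → f A ≤ f B) →
      ∑ γ ∈ M.powerset with apExpC M C γ ≤ J, (f (γ ∪ C) - f (M \ γ ∪ C)) * (g (γ ∪ C) - g (M \ γ ∪ C)) ≤ 0 from
    fun S' hS' f hf hfm => key S'.card S' le_rfl hS' f hf hfm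
  intro n
  induction n with
  | zero =>
    intro S' hcard hS' f hf hfm
    rcases hrule S' hS' f hf hfm with h | ⟨e, he, _⟩ | ⟨e, he, _⟩
    · exact h
    · exact absurd (Finset.card_pos.2 ⟨e, he⟩) (by omega)
    · exact absurd (Finset.card_pos.2 ⟨e, he⟩) (by omega)
  | succ n ih =>
    intro S' hcard hS' f hf hfm
    rcases hrule S' hS' f hf hfm with h | ⟨e, he, hcert⟩ | ⟨e, he, hcert⟩
    · exact h
    · -- lower `e`
      have hcard' : (S'.erase e).card ≤ n := by rw [Finset.card_erase_of_mem he]; omega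
      have hsub' : S'.erase e ⊆ S := (Finset.erase_subset e S').trans hS'
      have hlow := ih (S'.erase e) hcard' hsub' (fun A => f (A \ {e})) (notRead_comp_sdiff_singleton hf e)
        (mono_comp_sdiff_singleton hfm e)
      exact levels_le_of_lower M C f g e J hlow hcert
    · -- raise `e`
      have hcard' : (S'.erase e).card ≤ n := by rw [Finset.card_erase_of_mem he]; omega
      have hsub' : S'.erase e ⊆ S := (Finset.erase_subset e S').trans hS'
      have hup := ih (S'.erase e) hcard' hsub' (fun A => f (insert e A)) (notRead_comp_insert hf e) (mono_comp_insert hfm e)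
      exact levels_le_of_raise M C f g e J hup hcert

end FK

end Summit.CriticalPhenomena.PercolationContinuityZ3.Theorems

end
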